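import Literature.Barriers.CriticalPhenomena.KozmaNachmiasLemma11Steps
import Literature.Probability.Percolation.SiteConnectionTools
import HarnessLib

/-!
# Crux `PercNonProliferation.FreeBoxPowerSaving` (stmt-CriticalPhenomena-4447), line `Sketch` (card `l2-gluing-defect-rg`) — stub `stub_pairSumShift`

Helper file for the crux skeleton `Cruxes/FreeBoxPowerSaving/Lines/Sketch.lean`
(lead prover-line-stmt-CriticalPhenomena-4447-a1-0).  Proves exactly the registered stub signature
`stub_pairSumShift` (A0a, translation invariance of the free-box pair sum); lands with
`--supports stmt-CriticalPhenomena-4447`.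

## The statement

Bond percolation `P_p` on `ℤ³`, free box `B(n) = box 3 n = [-n,n]³`, pair sum
`S_p(n) = Σ_{x,y ∈ B(n)} P_p(x ↔ y inside B(n))`.  For every `p`, `n` and every shift `z ∈ ℤ³`,
the pair sum of the translated free box `z + B(n)` (connections inside the translated box,
endpoints translated) equals `S_p(n)`:
`Σ_{x,y ∈ B(n)} P_p(x + z ↔ y + z inside z + B(n)) = S_p(n)`.

## The argument

Termwise: the translation `w ↦ w + z` is the graph automorphism `zdShiftIso z` of `ℤ³`
(`zdShiftIso_apply : zdShiftIso z w = w + z` is `rfl`), so each summand is an instance of the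
invariance of `P_p(x ↔ y in S)` under automorphisms of `ℤ^d`
(`Literature.Barriers.CriticalPhenomena.real_openConnIn_image_iso`, Grimmett 1999 §1.6), with
`S = B(n)`; then `Finset.sum_congr` twice.

Tree API: `real_openConnIn_image_iso` (`KozmaNachmiasLemma11Steps.lean`), `zdShiftIso`,
`zdShiftIso_apply` (`SiteConnectionTools.lean`).
-/

noncomputable section

open MeasureTheory
open Literature.Probability.Percolation Literature.Probability.LatticeModels
open scoped BigOperators

namespace Summit.CriticalPhenomena.PercolationContinuityZ3.FreeBoxPowerSavingLine

open Literature.Barriers.CriticalPhenomena (real_openConnIn_image_iso)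

namespace PairSumShift

/-- One summand: `P_p(x + z ↔ y + z inside z + B(n)) = P_p(x ↔ y inside B(n))`, the translation
`w ↦ w + z` being the automorphism `zdShiftIso z` of `ℤ³` (Grimmett 1999, §1.6). [folklore] -/
theorem real_openConnIn_add_box (p : unitInterval) (n : ℕ) (z x y : Site 3) :
    (bondPercolation (zdGraph 3) p).real
        (openConnIn ((fun w : Site 3 => w + z) '' (↑(box 3 n) : Set (Site 3))) (x + z) (y + z)) =
      (bondPercolation (zdGraph 3) p).real (openConnIn (↑(box 3 n) : Set (Site 3)) x y) := by
  have hfun : (fun w : Site 3 => w + z) = ⇑(zdShiftIso (d := 3) z) := by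
    funext w
    exact (zdShiftIso_apply z w).symm
  rw [hfun]
  exact real_openConnIn_image_iso p (zdShiftIso z) (↑(box 3 n) : Set (Site 3)) x y

end PairSumShift

/-- **stub_pairSumShift (A0a, translation invariance of the free-box pair sum; every `p`).**
For bond percolation on `ℤ³`, every `p`, `n` and shift `z ∈ ℤ³`:
`Σ_{x,y ∈ B(n)} P_p(x + z ↔ y + z inside z + B(n)) = Σ_{x,y ∈ B(n)} P_p(x ↔ y inside B(n))`.
Proof: termwise `real_openConnIn_image_iso p (zdShiftIso z) ↑(box 3 n) x y`
(`PairSumShift.real_openConnIn_add_box`), summed with `Finset.sum_congr` (Grimmett 1999, §1.6).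
[folklore] -/
theorem stub_pairSumShift :
    ∀ (p : unitInterval) (n : ℕ) (z : Site 3),
      (∑ x ∈ box 3 n, ∑ y ∈ box 3 n,
        (bondPercolation (zdGraph 3) p).real
          (openConnIn ((fun w : Site 3 => w + z) '' (↑(box 3 n) : Set (Site 3))) (x + z) (y + z))) =
      ∑ x ∈ box 3 n, ∑ y ∈ box 3 n,
        (bondPercolation (zdGraph 3) p).real (openConnIn (↑(box 3 n) : Set (Site 3)) x y) := by
  intro p n z
  refine Finset.sum_congr rfl fun x _ => Finset.sum_congr rfl fun y _ => ?_
  exact PairSumShift.real_openConnIn_add_box p n z x y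

end Summit.CriticalPhenomena.PercolationContinuityZ3.FreeBoxPowerSavingLine

end
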